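import Mathlib.Analysis.SpecialFunctions.Pow.Real
import Mathlib.Analysis.SpecialFunctions.Log.Basic
import Literature.NumberTheory.DiophantineApproximation.ApproximationSequenceMeasure
import HarnessLib

/-!
# ζ(5) search — criterion C4: the irrationality MEASURE of a hit (cell `pub-zeta5`, TYPER)

HONEST FRAMING: systematic search; no irrationality claim unless certified.

`CRITERIA.md` C4 in Lean. A HIT of the search (criterion C1: integer forms `q_r ξ - p_r` of size
`e^{-σ r}`, coefficients `|q_r| ≤ e^{Q r}`, margin `σ > 0`) is upgraded to an EFFECTIVE
irrationality measure `μ(ξ) ≤ 1 + Q/σ` as soon as the bounds hold for EVERY `r` with explicit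
constants and consecutive approximations are never proportional (`p_r q_{r+1} ≠ p_{r+1} q_r`, the
Casoratian condition of the recurrence-first certificate). This is the tree's PROVED
Thue–Siegel–Baker closing lemma
`Literature.NumberTheory.DiophantineApproximation.one_div_lt_abs_sub_div_of_approx`
(Chen–Voutier 1997, §2 Lemma 8) with `Q_CV = e^{Q}`, `E = e^{σ}`, `κ = log Q_CV / log E = Q/σ`:

* `one_div_lt_abs_sub_div_of_exp_rates` — for all integers `a, b` with `|b| ≥ 1/(2 l₀)`:
  `|ξ - a/b| > 1 / (2 k₀ e^{Q} (2 e^{σ} l₀)^{Q/σ} · |b|^{Q/σ + 1})`.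

In Brown–Zudilin's "worthiness" normalisation (`|ξ - p_r/q_r| < q_r^{-γ+ε}`, `γ = 1 + σ/Q`) the
exponent is `Q/σ + 1 = γ/(γ - 1)`. Everything here is PROVED; no definitions, no named facts.
-/

noncomputable section

open Real

namespace Summit.KontsevichZagierPeriods.Zeta5Search

/-- **Effective irrationality measure from exponential rates** (cell `CRITERIA.md` C4). Let
`ξ ∈ ℝ`, `σ, Q, k₀, l₀ > 0` and integers `p_r, q_r` (`r ∈ ℕ`) with `|q_r| < k₀ e^{Q r}`,
`|q_r ξ - p_r| ≤ l₀ e^{-σ r}` and `p_r q_{r+1} ≠ p_{r+1} q_r` for every `r`. Then for all integers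
`a, b` with `|b| ≥ 1/(2 l₀)`:
`|ξ - a/b| > 1 / (2 k₀ e^{Q} (2 e^{σ} l₀)^{Q/σ} |b|^{Q/σ + 1})` — i.e. `μ(ξ) ≤ 1 + Q/σ`, effectively.
(The tree's `one_div_lt_abs_sub_div_of_approx` with `Q_CV = e^{Q}`, `E = e^{σ}`.) -/
theorem one_div_lt_abs_sub_div_of_exp_rates {ξ σ Q k₀ l₀ : ℝ} (hσ : 0 < σ) (hQ : 0 < Q)
    (hk₀ : 0 < k₀) (hl₀ : 0 < l₀) {p q : ℕ → ℤ}
    (hq : ∀ r : ℕ, |(q r : ℝ)| < k₀ * Real.exp (Q * r))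
    (happrox : ∀ r : ℕ, |(q r : ℝ) * ξ - p r| ≤ l₀ * Real.exp (-(σ * r)))
    (hne : ∀ r : ℕ, p r * q (r + 1) ≠ p (r + 1) * q r) (a b : ℤ)
    (hb : 1 / (2 * l₀) ≤ |(b : ℝ)|) :
    1 / (2 * k₀ * Real.exp Q * (2 * Real.exp σ * l₀) ^ (Q / σ) * |(b : ℝ)| ^ (Q / σ + 1)) <
      |ξ - a / b| := by
  have hE : 1 < Real.exp σ := Real.one_lt_exp_iff.2 hσ
  have hQ' : 1 < Real.exp Q := Real.one_lt_exp_iff.2 hQ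
  have hκ : Real.log (Real.exp Q) / Real.log (Real.exp σ) = Q / σ := by
    rw [Real.log_exp, Real.log_exp]
  have hq' : ∀ r : ℕ, |(q r : ℝ)| < k₀ * Real.exp Q ^ r := by
    intro r
    have e : Real.exp Q ^ r = Real.exp (Q * r) := by
      rw [← Real.exp_nat_mul]; ring_nf
    rw [e]; exact hq r
  have happrox' : ∀ r : ℕ, |(q r : ℝ) * ξ - p r| ≤ l₀ / Real.exp σ ^ r := by
    intro r
    have e : l₀ / Real.exp σ ^ r = l₀ * Real.exp (-(σ * r)) := by
      rw [← Real.exp_nat_mul, Real.exp_neg, div_eq_mul_inv]; ring_nf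
    rw [e]; exact happrox r
  have h := Literature.NumberTheory.DiophantineApproximation.one_div_lt_abs_sub_div_of_approx
    hk₀ hl₀ hE hQ' hq' happrox' hne a b hb
  rw [hκ] at h
  exact h

end Summit.KontsevichZagierPeriods.Zeta5Search
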